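import Summits.FinalStateConjecture.FinalStateConjecture.Theses.RobustClausewiseGenericity
import Summits.FinalStateConjecture.FinalStateConjecture.Theorems.RobustClausewiseGenericityAssembly
import HarnessLib

/-!
# Crux `CensorshipRobust` (stmt-FinalStateConjecture-10131) · split child `CensorshipWalls` · birth skeleton

Line `censored-open-and-thresholds` for the piece `CensorshipWalls` (wall structure of the naked-singularity
stratum) of the typed decomposition `CensorshipWalls → TameAxisSuperposition → CensorshipRobust`
(`Theorems/…/StrategySplit.lean`, `censorshipRobust_of_subs`). Two registered stubs of DIFFERENT physical nature
and the kernel-checked composition `CensorshipWalls_of`: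

* `stub_censoredIsProbeOpen` — STABILITY OF CENSORSHIP along compactly supported probes: if every MGHD of the
  admissible datum `d` has complete `𝓘⁺`, then so does every MGHD of `G c` for `c` near the base point of every
  tame probe `G` through `d` (contains: stability of dispersal, Christodoulou–Klainerman; completeness of `𝓘⁺`
  for compactly supported perturbations of black-hole-forming data — the large-data exterior-stability regime).
  Why it might fail: a "marginally censored" datum which is a probe-limit of naked-singularity data (an open end
  of a threshold curve) — then walls through CENSORED data are needed and the line is reshaped (walls at every
  datum in the probe-closure of the non-censored set).
* `stub_nakedThresholdWalls` — THRESHOLD STRUCTURE AT NAKED-SINGULARITY DATA: at an admissible datum with SOME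
  MGHD of incomplete `𝓘⁺`, the non-censored data near the base point of every tame probe lie on finitely many
  level sets `{Λⱼ = Λⱼ d}` of probe-differentiable, crossable functionals (critical-collapse picture: the
  naked-singularity stratum is the black-hole threshold, a `C¹` hypersurface = stable manifold of the critical
  solution; model theorems Christodoulou 1999 Thm 4.1, Angelopoulos–Kehle–Unger 2026 Thm 2). Why it might fail:
  Cantor families / one-sided accumulation of thresholds, cusps, infinitely many walls, or an RSR-type stratum of
  unknown regularity.

`CensorshipWalls_of`: case split on `Q_B d`; in the censored case `J = 0` and (ii) is exactly probe-openness.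
The piece is defined here VERBATIM (as in the strategist's `Sketch.lean` / the split child); after
`route edit --split` it is the route decl `Theses.RobustClausewiseGenericity.CensorshipWalls`.
-/

noncomputable section

namespace Summit.FinalStateConjecture.FinalStateConjecture.Cruxes.CensorshipRobust.CensorshipWallsBirth

open Literature.Geometry.Lorentzian
open Summit.FinalStateConjecture.FinalStateConjecture.Theorems.RobustClausewiseGenericity (Tame)
open Set Function Filter
open scoped Manifold ContDiff Topology

set_option linter.dupNamespace false

/-- The split child `CensorshipWalls`, verbatim. -/
def CensorshipWalls : Prop :=
  ∀ (X : Type) [TopologicalSpace X] [ChartedSpace Literature.Geometry.Lorentzian.E3 X] [IsManifold (𝓡 3) ((⊤ : ℕ∞) : WithTop ℕ∞) X] [T2Space X] [SecondCountableTopology X] [ConnectedSpace X], ∀ d ∈ Literature.Geometry.Lorentzian.admissibleVacuumData X, let Tame : (m : ℕ) → (EuclideanSpace ℝ (Fin m) → Literature.Geometry.Lorentzian.InitialDataSet (𝓡 3) X) → Prop := fun m G ↦ Literature.Geometry.Lorentzian.InitialDataSet.IsSmoothDataFamily m G ∧ G 0 = d ∧ (∀ c, G c ∈ Literature.Geometry.Lorentzian.admissibleVacuumData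 X) ∧ ∃ K : Set X, IsCompact K ∧ ∀ c, ∀ x ∉ K, (G c).h.inner x = d.h.inner x ∧ (G c).k x = d.k x; let Q : Literature.Geometry.Lorentzian.InitialDataSet (𝓡 3) X → Prop := fun D ↦ ∀ 𝒟 : Literature.Geometry.Lorentzian.VacuumCauchyDevelopment D, 𝒟.IsMaximal → Summit.FinalStateConjecture.HasCompleteNullInfinity 𝒟.toCauchyDevelopment; ∃ (J : ℕ) (Λ : Fin J → Literature.Geometry.Lorentzian.InitialDataSet (𝓡 3) X → ℝ), (∀ (m : ℕ) (G : EuclideanSpace ℝ (Fin m) → Literature.Geometry.Lorentzian.InitialDataSet (𝓡 3) X), Tame m G → ∀ j, DifferentiableAt ℝ (Λ j ∘ G) 0) ∧ (∀ j, ∃ γ : EuclideanSpace ℝ (Fin 1) → Literature.Geometry.Lorentzian.InitialDataSet (𝓡 3) X, Tame 1 γ ∧ fderiv ℝ (Λ j ∘ γ) 0 ≠ 0) ∧ ∀ (m : ℕ) (G : EuclideanSpace ℝ (Fin m) → Literature.Geometry.Lorentzian.InitialDataSet (𝓡 3) X), Tame m G → ∃ δ : ℝ, 0 < δ ∧ ∀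 c, ‖c‖ < δ → (∀ j, Λ j (G c) ≠ Λ j d) → Q (G c)

/-- **stub_censoredIsProbeOpen** — STABILITY OF CENSORSHIP ALONG COMPACTLY SUPPORTED PROBES: at an admissible
datum all of whose MGHDs have complete `𝓘⁺`, every tame probe has complete `𝓘⁺` (all MGHDs) for all
parameters near the base point. Plausibly L–XL: dispersive data by stability of Minkowski; black-hole-forming
data = large-data exterior stability. -/
theorem stub_censoredIsProbeOpen :
    ∀ (X : Type) [TopologicalSpace X] [ChartedSpace E3 X] [IsManifold (𝓡 3) ∞ X] [T2Space X]
      [SecondCountableTopology X] [ConnectedSpace X], ∀ d ∈ admissibleVacuumData X,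
      (∀ 𝒟 : VacuumCauchyDevelopment d, 𝒟.IsMaximal →
        Summit.FinalStateConjecture.HasCompleteNullInfinity 𝒟.toCauchyDevelopment) →
      ∀ (m : ℕ) (G : EuclideanSpace ℝ (Fin m) → InitialDataSet (𝓡 3) X), Tame d m G →
        ∃ δ : ℝ, 0 < δ ∧ ∀ c, ‖c‖ < δ →
          ∀ 𝒟 : VacuumCauchyDevelopment (G c), 𝒟.IsMaximal →
            Summit.FinalStateConjecture.HasCompleteNullInfinity 𝒟.toCauchyDevelopment := by
  sorry

/-- **stub_nakedThresholdWalls** — THRESHOLD STRUCTURE AT NAKED-SINGULARITY DATA: at an admissible datum with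
some MGHD of incomplete `𝓘⁺`, finitely many probe-differentiable, crossable functionals whose level sets through
`d` capture the non-censored data near the base point of every tame probe. Open-problem (positive-codimension
weak cosmic censorship with `C¹` thresholds). -/
theorem stub_nakedThresholdWalls :
    ∀ (X : Type) [TopologicalSpace X] [ChartedSpace E3 X] [IsManifold (𝓡 3) ∞ X] [T2Space X]
      [SecondCountableTopology X] [ConnectedSpace X], ∀ d ∈ admissibleVacuumData X,
      (¬ ∀ 𝒟 : VacuumCauchyDevelopment d, 𝒟.IsMaximal →
        Summit.FinalStateConjecture.HasCompleteNullInfinity 𝒟.toCauchyDevelopment) →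
      ∃ (J : ℕ) (Λ : Fin J → InitialDataSet (𝓡 3) X → ℝ),
        (∀ (m : ℕ) (G : EuclideanSpace ℝ (Fin m) → InitialDataSet (𝓡 3) X), Tame d m G →
          ∀ j, DifferentiableAt ℝ (Λ j ∘ G) 0) ∧
        (∀ j, ∃ γ : EuclideanSpace ℝ (Fin 1) → InitialDataSet (𝓡 3) X, Tame d 1 γ ∧ fderiv ℝ (Λ j ∘ γ) 0 ≠ 0) ∧
        ∀ (m : ℕ) (G : EuclideanSpace ℝ (Fin m) → InitialDataSet (𝓡 3) X), Tame d m G →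
          ∃ δ : ℝ, 0 < δ ∧ ∀ c, ‖c‖ < δ → (∀ j, Λ j (G c) ≠ Λ j d) →
            ∀ 𝒟 : VacuumCauchyDevelopment (G c), 𝒟.IsMaximal →
              Summit.FinalStateConjecture.HasCompleteNullInfinity 𝒟.toCauchyDevelopment := by
  sorry

/-- **Composition** `stub_censoredIsProbeOpen → stub_nakedThresholdWalls → CensorshipWalls`: case split on
whether `d` is censored; at censored data no wall is needed (`J = 0`) and (ii) is probe-openness. -/
theorem CensorshipWalls_of :
    (∀ (X : Type) [TopologicalSpace X] [ChartedSpace E3 X] [IsManifold (𝓡 3) ∞ X] [T2Space X]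
      [SecondCountableTopology X] [ConnectedSpace X], ∀ d ∈ admissibleVacuumData X,
      (∀ 𝒟 : VacuumCauchyDevelopment d, 𝒟.IsMaximal →
        Summit.FinalStateConjecture.HasCompleteNullInfinity 𝒟.toCauchyDevelopment) →
      ∀ (m : ℕ) (G : EuclideanSpace ℝ (Fin m) → InitialDataSet (𝓡 3) X), Tame d m G →
        ∃ δ : ℝ, 0 < δ ∧ ∀ c, ‖c‖ < δ →
          ∀ 𝒟 : VacuumCauchyDevelopment (G c), 𝒟.IsMaximal →
            Summit.FinalStateConjecture.HasCompleteNullInfinity 𝒟.toCauchyDevelopment) →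
    (∀ (X : Type) [TopologicalSpace X] [ChartedSpace E3 X] [IsManifold (𝓡 3) ∞ X] [T2Space X]
      [SecondCountableTopology X] [ConnectedSpace X], ∀ d ∈ admissibleVacuumData X,
      (¬ ∀ 𝒟 : VacuumCauchyDevelopment d, 𝒟.IsMaximal →
        Summit.FinalStateConjecture.HasCompleteNullInfinity 𝒟.toCauchyDevelopment) →
      ∃ (J : ℕ) (Λ : Fin J → InitialDataSet (𝓡 3) X → ℝ),
        (∀ (m : ℕ) (G : EuclideanSpace ℝ (Fin m) → InitialDataSet (𝓡 3) X), Tame d m G →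
          ∀ j, DifferentiableAt ℝ (Λ j ∘ G) 0) ∧
        (∀ j, ∃ γ : EuclideanSpace ℝ (Fin 1) → InitialDataSet (𝓡 3) X, Tame d 1 γ ∧ fderiv ℝ (Λ j ∘ γ) 0 ≠ 0) ∧
        ∀ (m : ℕ) (G : EuclideanSpace ℝ (Fin m) → InitialDataSet (𝓡 3) X), Tame d m G →
          ∃ δ : ℝ, 0 < δ ∧ ∀ c, ‖c‖ < δ → (∀ j, Λ j (G c) ≠ Λ j d) →
            ∀ 𝒟 : VacuumCauchyDevelopment (G c), 𝒟.IsMaximal →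
              Summit.FinalStateConjecture.HasCompleteNullInfinity 𝒟.toCauchyDevelopment) →
    CensorshipWalls := by
  intro hopen hwalls X _ _ _ _ _ _ d hd
  dsimp only
  by_cases hQ : ∀ 𝒟 : VacuumCauchyDevelopment d, 𝒟.IsMaximal →
      Summit.FinalStateConjecture.HasCompleteNullInfinity 𝒟.toCauchyDevelopment
  · -- censored base datum: no wall, (ii) = probe-openness
    refine ⟨0, fun j => j.elim0, fun m G hG j => j.elim0, fun j => j.elim0, fun m G hG => ?_⟩
    obtain ⟨δ, hδ, h⟩ := hopen X d hd hQ m G hG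
    exact ⟨δ, hδ, fun c hc _ => h c hc⟩
  · -- naked-singularity base datum: the threshold walls
    exact hwalls X d hd hQ

end Summit.FinalStateConjecture.FinalStateConjecture.Cruxes.CensorshipRobust.CensorshipWallsBirth

end
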